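import Summits.NavierStokesRegularity.NavierStokesRegularity.Theorems.PerpetualPumpPumpTransferModeCoeffOfBandField
import Summits.NavierStokesRegularity.NavierStokesRegularity.Theorems.PerpetualPumpPumpTransferBandSums
import Summits.NavierStokesRegularity.NavierStokesRegularity.Theorems.PerpetualPumpPumpTransferFibreBounds
import Summits.NavierStokesRegularity.NavierStokesRegularity.Theorems.PerpetualPumpEulerTypeIGlueDuhamel
import Literature.Analysis.FluidPDE.TaoCascadeMotion
import Mathlib.MeasureTheory.Integral.DominatedConvergence
import HarnessLib

/-!
# `PerpetualPump.PumpTransfer` (stmt-NavierStokesRegularity-1837), line `Sketch`, stub `stub_mild_of_bandField`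

Registered stub of the lead's skeleton `Cruxes/PumpTransfer/Lines/Sketch.lean` (lead prover
prover-line-stmt-NavierStokesRegularity-1837-0). SYNTHESIS direction of Lemma 4.1: a band-structured `H¹⁰_df`
curve whose coefficients solve the lifted Volterra system is a mild solution of the cascade equation (3.3).

Vocabulary: Tao's cascade operator (4.1) with wavelet data `𝒟 : CascadeWaveletData ε₀ m`
(`Literature/Analysis/FluidPDE/TaoCascadeOperator.lean`), the heat fibres `duhamelScalar δ Qr L t`,
weights `modeWeight 𝒟 i n = |ψ̂_{i,n}|²` and `modeDelta` (`TaoCascadeDuhamel.lean`), `heatRate ξ = 4π²|ξ|²`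
(`TaoBandHeatGroup.lean`), the circuit nonlinearity `TaoCascade.quadTerm` (`TaoCascadeODE.lean`).

## The argument

With `p = (i,n)`, `Q_p(s) = quadTerm_p(X(max(s,0)))`, `δ_p = A 1_{p=(i₀,n₀)}`, `φ_p(ξ) = duhamelScalar δ_p Q_p (4π²|ξ|²) t`
(so `û(t) = ∑_p φ_p ψ̂_p` a.e.), fix `t ∈ [0,S)` and `w ∈ H¹⁰_df`.
* (L) The one-mode field `F_p = δ_p e^{tΔ}ψ_p + M_t(D)ψ_p` (`M_t` the Duhamel multiplier of `Q_p`) has `F̂_p = φ_p ψ̂_p`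
  (`ofReal_mul_heatSymbol_add_duhamelSymbolFn`) and `⟨F_p, w⟩ = δ_p⟨e^{tΔ}ψ_p, w⟩ + ∫₀ᵗ Q_p(s)⟨e^{(t-s)Δ}ψ_p, w⟩ ds`
  (`pairing_fourierMultiplier_duhamelSymbol`); Parseval and a dominated interchange (`|φ_p| ≤ |δ_p| + tK b_n`, `∑ b_n < ∞`,
  `|⟪ŵ,ψ̂_p⟫| ≤ |ŵ|² + |ψ̂_p|²`) give `⟨u(t), w⟩ = ∑_p ⟨F_p, w⟩` (`pairing_bandField_eq_tsum`).
* (R) For `s ∈ [0,t]`, `⟨u(s), ψ_{j,k}⟩ = X_{j,k}(s)` (real part: the landed `stub_modeCoeff_of_bandField` and the Volterra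
  hypothesis; imaginary part: real fields), so `⟨C(u(s),u(s)), g⟩ = ∑_p Q_p(s)⟨g, ψ_p⟩` after reindexing the absolutely
  summable scale series (`cascadeOperatorForm_eq_tsum_quadTerm`); with `g = e^{(t-s)Δ}w`, `∑_p` and `∫₀ᵗ` are exchanged
  (`hasSum_integral_duhamelTerms`). The datum terms add up to `⟨e^{tΔ}(Aψ_{i₀,n₀}), w⟩`.

## References

* T. Tao, J. Amer. Math. Soc. 29 (2016), 601–674 = arXiv:1402.0290v3, §4 Lemma 4.1 (4.14). [`Tao2016AveragedNS`]
-/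

noncomputable section

-- the nested summit namespace is the tree's layout (D-0017)
set_option linter.dupNamespace false

namespace Summit.NavierStokesRegularity.NavierStokesRegularity.Theorems.PerpetualPumpPumpTransfer

open MeasureTheory Set Filter Topology FourierTransform
open scoped ENNReal SchwartzMap
open Literature.Analysis Literature.Analysis.FluidPDE Literature.Analysis.FluidPDE.Tao2016
-- the heat propagator on `L²`: strong continuity and contraction (toolkit of the sibling route item `EulerTypeIGlue`)
open Summit.NavierStokesRegularity.NavierStokesRegularity.Theorems.PerpetualPumpEulerTypeIGlue
  (continuous_heat_apply norm_heat_le)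

variable {ε₀ : ℝ} {m : ℕ}

/-! ### Tools: the one-mode symbol, summability, reindexing -/

/-- **The symbol of a one-mode Duhamel field is the scalar heat fibre**: for `t ≥ 0` and `L = 4π²|ξ|²`,
`δ e^{-tL} + ∫₀ᵗ Qr(s) e^{-(t-s)L} ds = e^{-Lt}(δ + ∫₀ᵗ Qr e^{Ls})`. [cite: Tao2016AveragedNS, §4 Lemma 4.1 (4.14)] -/
theorem ofReal_mul_heatSymbol_add_duhamelSymbolFn (δ : ℝ) (Qr : ℝ → ℝ) {t : ℝ} (ht : 0 ≤ t)
    (ξ : EuclideanSpace ℝ (Fin 3)) : ((δ : ℝ) : ℂ) * heatSymbol t ξ + duhamelSymbolFn (fun s => ((Qr s : ℝ) : ℂ)) t ξ =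
      ((duhamelScalar δ Qr (heatRate ξ) t : ℝ) : ℂ) := by
  have hint : duhamelSymbolFn (fun s => ((Qr s : ℝ) : ℂ)) t ξ =
      ((∫ s in (0 : ℝ)..t, Qr s * Real.exp (-(heatRate ξ * (t - s))) : ℝ) : ℂ) := by
    rw [duhamelSymbolFn, ← intervalIntegral.integral_ofReal]
    refine intervalIntegral.integral_congr fun s hs => ?_
    rw [uIcc_of_le ht] at hs
    rw [heatSymbol_eq_exp_heatRate (by linarith [hs.2])]
    push_cast
    ring
  rw [hint, heatSymbol_eq_exp_heatRate ht, ← Complex.ofReal_mul, ← Complex.ofReal_add, duhamelScalar, mul_add,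
    ← intervalIntegral.integral_const_mul]
  congr 2
  · ring
  · refine intervalIntegral.integral_congr fun s _ => ?_
    rw [show -(heatRate ξ * (t - s)) = -(heatRate ξ * t) + heatRate ξ * s by ring, Real.exp_add]
    ring

/-- **Summability of the mode bounds** `b_n = ((aⁿ)²+(aⁿ)³)/(1+(aⁿ)^{10})²` over the modes `(i,n)`, `a > 1`
(`n ≥ 0`: below the summands of `summable_decay`; `n < 0`: below `2a^{-|n|}`). [folklore] -/
theorem summable_fibreBound {a : ℝ} (ha : 1 < a) (m : ℕ) :
    Summable fun p : Fin m × ℤ => ((a ^ p.2) ^ 2 + (a ^ p.2) ^ 3) / (1 + (a ^ p.2) ^ 10) ^ 2 := by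
  have hr0 : 0 ≤ a⁻¹ := by positivity
  have hr1 : a⁻¹ < 1 := inv_lt_one_of_one_lt₀ ha
  have hZ : Summable fun n : ℤ => ((a ^ n) ^ 2 + (a ^ n) ^ 3) / (1 + (a ^ n) ^ 10) ^ 2 := by
    refine Summable.of_nat_of_neg ?_ ?_
    · refine Summable.of_nonneg_of_le (fun n => by positivity) (fun n => ?_)
        ((summable_decay ha).comp_injective Nat.cast_injective)
      have hc1 : 1 ≤ a ^ (n : ℤ) := one_le_zpow₀ ha.le (Int.natCast_nonneg n)
      exact div_le_div_of_nonneg_right (le_self_pow₀ (le_add_of_le_of_nonneg (one_le_pow₀ hc1) (by positivity))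
        two_ne_zero) (by positivity)
    · refine Summable.of_nonneg_of_le (fun n => by positivity) (fun n => ?_)
        ((summable_geometric_of_lt_one hr0 hr1).mul_left 2)
      rw [zpow_neg, zpow_natCast, ← inv_pow]
      have hd0 : 0 < a⁻¹ ^ n := by positivity
      have hd1 : a⁻¹ ^ n ≤ 1 := pow_le_one₀ hr0 hr1.le
      have h2 : (a⁻¹ ^ n) ^ 2 ≤ a⁻¹ ^ n := by nlinarith
      have h3 : (a⁻¹ ^ n) ^ 3 ≤ a⁻¹ ^ n := by nlinarith
      exact (div_le_self (by positivity) (one_le_pow₀ (by nlinarith [pow_nonneg hd0.le 10]))).trans (by linarith)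
  simpa only [one_mul] using (Summable.of_finite (L := .unconditional _) (f := fun _ : Fin m => (1 : ℝ))).mul_of_nonneg
    hZ (fun _ => zero_le_one) (fun n => by positivity)

/-- A nonnegative term is bounded by the triple sum it belongs to. [folklore] -/
theorem single_le_sum₃ {ι κ : Type*} [Fintype ι] (s : Finset κ) (f : ι → ι → κ → ℝ)
    (hf : ∀ a b c, 0 ≤ f a b c) (a b : ι) {c : κ} (hc : c ∈ s) : f a b c ≤ ∑ a', ∑ b', ∑ c' ∈ s, f a' b' c' :=
  calc f a b c ≤ ∑ x ∈ Finset.univ ×ˢ Finset.univ ×ˢ s, f x.1 x.2.1 x.2.2 :=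
        Finset.single_le_sum (f := fun x : ι × ι × κ => f x.1 x.2.1 x.2.2) (a := (a, b, c)) (fun x _ => hf _ _ _)
          (by simp [hc])
    _ = ∑ a', ∑ b', ∑ c' ∈ s, f a' b' c' := by
        rw [Finset.sum_product]; exact Finset.sum_congr rfl fun _ _ => Finset.sum_product _ _ _

/-- **Reindexing the cascade operator by output mode.** If every shifted piece is summable over the modes `p = (i₃, n)`,
then `∑_{i₁,i₂,i₃,μ} α ∑_n c_n P_{i₁,n+μ₁} P_{i₂,n+μ₂} G_{i₃,n+μ₃}` (the shape of (4.1)) equals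
`∑_{(i,n)} ∑_{i₁,i₂,μ} α_{i₁i₂iμ} c_{n-μ₃} P_{i₁,n-μ₃+μ₁} P_{i₂,n-μ₃+μ₂} G_{i,n}` (shift `n ↦ n - μ₃`). [cite: Tao2016AveragedNS, §4 (4.15)] -/
theorem cascadeSum_eq_tsum (α : Fin m → Fin m → Fin m → ℤ × ℤ × ℤ → ℝ) (c : ℤ → ℂ) (P G : Fin m → ℤ → ℂ)
    (hT : ∀ (i₁ i₂ : Fin m), ∀ μ ∈ TaoCascade.shiftSet, Summable fun p : Fin m × ℤ =>
      (α i₁ i₂ p.1 μ : ℂ) * c (p.2 - μ.2.2) * (P i₁ (p.2 - μ.2.2 + μ.1) * P i₂ (p.2 - μ.2.2 + μ.2.1)) * G p.1 p.2) :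
    ∑ i₁, ∑ i₂, ∑ i₃, ∑ μ ∈ TaoCascade.shiftSet, (α i₁ i₂ i₃ μ : ℂ) *
      ∑' n : ℤ, c n * (P i₁ (n + μ.1) * P i₂ (n + μ.2.1) * G i₃ (n + μ.2.2)) =
    ∑' p : Fin m × ℤ, ∑ i₁, ∑ i₂, ∑ μ ∈ TaoCascade.shiftSet,
      (α i₁ i₂ p.1 μ : ℂ) * c (p.2 - μ.2.2) * (P i₁ (p.2 - μ.2.2 + μ.1) * P i₂ (p.2 - μ.2.2 + μ.2.1)) * G p.1 p.2 := by
  rw [Summable.tsum_finsetSum (fun i₁ _ => summable_sum fun i₂ _ => summable_sum fun μ hμ => hT i₁ i₂ μ hμ)]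
  refine Finset.sum_congr rfl fun i₁ _ => ?_
  rw [Summable.tsum_finsetSum (fun i₂ _ => summable_sum fun μ hμ => hT i₁ i₂ μ hμ)]
  refine Finset.sum_congr rfl fun i₂ _ => ?_
  rw [Summable.tsum_finsetSum (fun μ hμ => hT i₁ i₂ μ hμ), Finset.sum_comm]
  refine Finset.sum_congr rfl fun μ hμ => ?_
  rw [Summable.tsum_prod' (hT i₁ i₂ μ hμ) (fun i₃ => (hT i₁ i₂ μ hμ).comp_injective (Prod.mk_right_injective i₃)),
    tsum_fintype]
  refine Finset.sum_congr rfl fun i₃ _ => ?_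
  rw [← tsum_mul_left, ← Equiv.tsum_eq (Equiv.subRight μ.2.2)]
  refine tsum_congr fun n => ?_
  simp only [Equiv.subRight_apply, sub_add_cancel]
  ring

/-! ### The three analytic steps -/

/-- **(L) Parseval for a band field, mode by mode**: if `v̂ = ∑_p c_p ψ̂_p` a.e. with continuous `|c_p| ≤ B_p`, `∑_p B_p < ∞`,
and `w` is real, then `⟨v, w⟩ = ∑_p ∫ c_p(ξ) ⟪ŵ(ξ), ψ̂_p(ξ)⟫ dξ` (a.e. one band term survives; the interchange is dominated by
`B_p(|ŵ|² + |ψ̂_p|²)`, `∫|ψ̂_p|² = 1`). [cite: Tao2016AveragedNS, §4 Lemma 4.1] -/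
theorem pairing_bandField_eq_tsum (hε₀ : 0 < ε₀) (𝒟 : CascadeWaveletData ε₀ m)
    {c : Fin m × ℤ → EuclideanSpace ℝ (Fin 3) → ℝ} (hc : ∀ p, Continuous (c p)) {B : Fin m × ℤ → ℝ}
    (hcB : ∀ p ξ, |c p ξ| ≤ B p) (hB : Summable B) {v w : L2C} (hv : fourierFn v =ᵐ[volume] fun ξ =>
      ∑' p : Fin m × ℤ, ((c p ξ : ℝ) : ℂ) • fourierFn (cascadeWavelet ε₀ (𝒟.ψ p.1) p.2) ξ) (hw : IsReal w) :
    pairing v w = ∑' p : Fin m × ℤ, ∫ ξ, ((c p ξ : ℝ) : ℂ) *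
      inner ℂ (fourierFn w ξ) (fourierFn (cascadeWavelet ε₀ (𝒟.ψ p.1) p.2) ξ) := by
  have hε' : 0 < 1 + ε₀ := by linarith
  have hW2 : ∫⁻ ξ, ‖fourierFn w ξ‖ₑ ^ 2 ∂(volume : Measure (EuclideanSpace ℝ (Fin 3))) < ∞ := by
    have h := (Lp.memLp (𝓕 w : L2C)).eLpNorm_lt_top
    rw [eLpNorm_lt_top_iff_lintegral_rpow_enorm_lt_top two_ne_zero ENNReal.ofNat_ne_top] at h
    simp only [ENNReal.toReal_ofNat, ENNReal.rpow_two] at h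
    exact h
  rw [pairing_eq_integral_fourierFn hw, ← integral_tsum]
  · refine integral_congr_ae ?_
    filter_upwards [hv, ae_wavelet_cases hε₀ 𝒟] with ξ h1 h2
    rw [h1]
    rcases h2 with hall | ⟨p₀, -, hoth⟩
    · simp [hall]
    · rw [tsum_eq_single p₀ (fun p hp => by rw [hoth p hp, smul_zero]),
        tsum_eq_single p₀ (fun p hp => by rw [hoth p hp, inner_zero_right, mul_zero]), inner_smul_right]
  · exact fun p => (Complex.continuous_ofReal.comp (hc p)).aestronglyMeasurable.mul ((Lp.aestronglyMeasurable
      (𝓕 w : L2C)).inner (Lp.aestronglyMeasurable (𝓕 (cascadeWavelet ε₀ (𝒟.ψ p.1) p.2) : L2C)))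
  · refine ne_of_lt (lt_of_le_of_lt (ENNReal.tsum_le_tsum
      (g := fun p => ENNReal.ofReal (B p) * ((∫⁻ ξ, ‖fourierFn w ξ‖ₑ ^ 2) + 1)) fun p => ?_) ?_)
    · calc _ ≤ ∫⁻ ξ, ENNReal.ofReal (B p) * (‖fourierFn w ξ‖ₑ ^ 2 + ‖fourierFn (cascadeWavelet ε₀ (𝒟.ψ p.1) p.2) ξ‖ₑ ^ 2) :=
          lintegral_mono fun ξ => ?_
        _ = ENNReal.ofReal (B p) * ((∫⁻ ξ, ‖fourierFn w ξ‖ₑ ^ 2) + 1) := by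
          rw [lintegral_const_mul' _ _ ENNReal.ofReal_ne_top,
            lintegral_add_left' (show AEMeasurable (fun ξ => ‖fourierFn w ξ‖ₑ ^ 2) volume from
              (Lp.aestronglyMeasurable _).aemeasurable.enorm.pow_const 2),
            lintegral_enorm_sq_fourierFn_cascadeWavelet hε' 𝒟 p.1 p.2]
      rw [enorm_mul]
      refine mul_le_mul' ?_ ?_
      · rw [← ofReal_norm, Complex.norm_real, Real.norm_eq_abs]
        exact ENNReal.ofReal_le_ofReal (hcB p ξ)
      · rw [← ofReal_norm, ← ofReal_norm, ← ofReal_norm, ← ENNReal.ofReal_pow (norm_nonneg _),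
          ← ENNReal.ofReal_pow (norm_nonneg _), ← ENNReal.ofReal_add (sq_nonneg _) (sq_nonneg _)]
        refine ENNReal.ofReal_le_ofReal ((norm_inner_le_norm _ _).trans ?_)
        nlinarith [sq_nonneg (‖fourierFn w ξ‖ - ‖fourierFn (cascadeWavelet ε₀ (𝒟.ψ p.1) p.2) ξ‖),
          mul_nonneg (norm_nonneg (fourierFn w ξ)) (norm_nonneg (fourierFn (cascadeWavelet ε₀ (𝒟.ψ p.1) p.2) ξ))]
    · rw [ENNReal.tsum_mul_right, ← ENNReal.ofReal_tsum_of_nonneg (fun p => (abs_nonneg _).trans (hcB p 0)) hB]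
      exact ENNReal.mul_lt_top ENNReal.ofReal_lt_top (ENNReal.add_lt_top.2 ⟨hW2, ENNReal.one_lt_top⟩)

/-- **(R) The Duhamel terms are summable over the modes, with sum the time integral of the mode sum**: for continuous
forcings `|Q_p| ≤ B_p` on `[0,t]`, `∑_p B_p < ∞`, `∑_p ∫₀ᵗ Q_p(s)⟨e^{(t-s)Δ}ψ_p, w⟩ ds = ∫₀ᵗ ∑_p Q_p(s)⟨e^{(t-s)Δ}ψ_p, w⟩ ds`
(`|⟨e^{τΔ}ψ_p, w⟩| ≤ ‖w‖`). [cite: Tao2016AveragedNS, §4 Lemma 4.1 (4.14)] -/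
theorem hasSum_integral_duhamelTerms (hε' : 0 < 1 + ε₀) (𝒟 : CascadeWaveletData ε₀ m)
    {Qf : Fin m × ℤ → ℝ → ℝ} (hQ : ∀ p, Continuous (Qf p)) {B : Fin m × ℤ → ℝ} (hB : Summable B)
    {t : ℝ} (hQB : ∀ p, ∀ s ∈ Icc (0 : ℝ) t, |Qf p s| ≤ B p) (w : L2C) :
    HasSum (fun p : Fin m × ℤ => ∫ s in Ioc (0 : ℝ) t,
        ((Qf p s : ℝ) : ℂ) * pairing (heat (t - s) (cascadeWavelet ε₀ (𝒟.ψ p.1) p.2)) w)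
      (∫ s in Ioc (0 : ℝ) t, ∑' p : Fin m × ℤ,
        ((Qf p s : ℝ) : ℂ) * pairing (heat (t - s) (cascadeWavelet ε₀ (𝒟.ψ p.1) p.2)) w) := by
  have hint : ∀ p : Fin m × ℤ, IntegrableOn (fun s : ℝ =>
      ((Qf p s : ℝ) : ℂ) * pairing (heat (t - s) (cascadeWavelet ε₀ (𝒟.ψ p.1) p.2)) w) (Ioc (0 : ℝ) t) :=
    fun p => (((Complex.continuous_ofReal.comp (hQ p)).mul (continuousOn_univ.1 (((continuous_heat_apply _).comp
      (continuous_const.sub continuous_id)).continuousOn.pairing_left w))).integrableOn_Icc (a := 0) (b := t)).mono_set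
        Ioc_subset_Icc_self
  refine hasSum_integral_of_summable_integral_norm (μ := volume.restrict (Ioc (0 : ℝ) t)) hint ?_
  refine Summable.of_nonneg_of_le (fun p => integral_nonneg fun s => norm_nonneg _) (fun p => ?_)
    ((hB.mul_right ‖w‖).mul_left (volume.real (Ioc (0 : ℝ) t)))
  calc ∫ s in Ioc (0 : ℝ) t, ‖((Qf p s : ℝ) : ℂ) * pairing (heat (t - s) (cascadeWavelet ε₀ (𝒟.ψ p.1) p.2)) w‖
      ≤ ∫ s in Ioc (0 : ℝ) t, B p * ‖w‖ := by
        refine setIntegral_mono_on (hint p).norm (integrableOn_const (measure_Ioc_lt_top.ne)) measurableSet_Ioc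
          fun s hs => ?_
        rw [norm_mul, Complex.norm_real, Real.norm_eq_abs]
        refine mul_le_mul (hQB p s ⟨hs.1.le, hs.2⟩) ((norm_pairing_le _ _).trans ?_) (norm_nonneg _)
          ((abs_nonneg _).trans (hQB p s ⟨hs.1.le, hs.2⟩))
        exact mul_le_of_le_one_left (norm_nonneg _) ((norm_heat_le _ _).trans_eq (𝒟.norm_cascadeWavelet hε' p.1 p.2))
    _ = volume.real (Ioc (0 : ℝ) t) * (B p * ‖w‖) := by rw [setIntegral_const, smul_eq_mul]

/-- **(4) The cascade operator on a field with coefficients `X_{j,k}(s)`**: if `⟨f, ψ_{j,k}⟩ = X_{j,k}(s)` with the weighted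
bound `(1+(1+ε₀)^{10k})|X_{j,k}(s)| ≤ C`, then every scale series in `⟨C(f,f), g⟩` (4.1) is absolutely summable and
`⟨C(f,f), g⟩ = ∑_{(i,n)} quadTerm_{i,n}(X(s)) ⟨g, ψ_{i,n}⟩` (majorant `K b_n ‖g‖` via `abs_quadTerm_le` for `|α|, |X|`). [cite: Tao2016AveragedNS, §4 (4.15)] -/
theorem cascadeOperatorForm_eq_tsum_quadTerm (hε₀ : 0 < ε₀) (hε₁ : ε₀ < 1) (𝒟 : CascadeWaveletData ε₀ m)
    (α : Fin m → Fin m → Fin m → ℤ × ℤ × ℤ → ℝ) (X : Fin m → ℤ → ℝ → ℝ) {C s : ℝ}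
    (hX : ∀ (j : Fin m) (k : ℤ), (1 + ((1 + ε₀) ^ k) ^ 10) * |X j k s| ≤ C) {f : L2C}
    (hf : ∀ (j : Fin m) (k : ℤ), pairing f (cascadeWavelet ε₀ (𝒟.ψ j) k) = ((X j k s : ℝ) : ℂ)) (g : L2C) :
    cascadeOperatorForm ε₀ 𝒟.ψ α f f g = ∑' p : Fin m × ℤ,
      ((TaoCascade.quadTerm ε₀ α X p.1 p.2 s : ℝ) : ℂ) * pairing g (cascadeWavelet ε₀ (𝒟.ψ p.1) p.2) := by
  have hε' : 0 < 1 + ε₀ := by linarith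
  set K : ℝ := (∑ i₃ : Fin m, ∑ i₁ : Fin m, ∑ i₂ : Fin m, ∑ μ ∈ TaoCascade.shiftSet, |α i₁ i₂ i₃ μ|) * (2 ^ 10 * C) ^ 2
    with hK
  set b : ℤ → ℝ := fun n => (((1 + ε₀) ^ n) ^ 2 + ((1 + ε₀) ^ n) ^ 3) / (1 + ((1 + ε₀) ^ n) ^ 10) ^ 2 with hb
  have hbsum : Summable fun p : Fin m × ℤ => b p.2 := summable_fibreBound (by linarith) m
  have habsq : ∀ (i : Fin m) (n : ℤ),
      TaoCascade.quadTerm ε₀ (fun a b c μ => |α a b c μ|) (fun j k s => |X j k s|) i n s ≤ K * b n := by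
    intro i n
    have h := abs_quadTerm_le hε₀ hε₁ (fun a b c μ => |α a b c μ|) (fun j k s => |X j k s|) (C := C) (s := s)
      (fun j k => by simp only [abs_abs]; exact hX j k) i n
    refine (le_abs_self _).trans (h.trans (le_of_eq ?_))
    simp only [abs_abs, hK, hb, div_pow]
    ring
  unfold cascadeOperatorForm
  simp only [hf]
  refine (cascadeSum_eq_tsum α (fun n : ℤ => (((1 + ε₀) ^ ((5 : ℝ) * (n : ℝ) / 2) : ℝ) : ℂ))
    (fun j k => ((X j k s : ℝ) : ℂ)) (fun j k => pairing g (cascadeWavelet ε₀ (𝒟.ψ j) k)) ?_).trans ?_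
  · -- every shifted piece is summable over the modes: `|term| ≤ K b_n ‖g‖`
    intro i₁ i₂ μ hμ
    refine Summable.of_norm_bounded (hbsum.mul_left (K * ‖g‖)) fun p => ?_
    have hcast : ((p.2 - μ.2.2 : ℤ) : ℝ) = (p.2 : ℝ) - (μ.2.2 : ℝ) := Int.cast_sub _ _
    have hA : ‖(α i₁ i₂ p.1 μ : ℂ) * (((1 + ε₀) ^ ((5 : ℝ) * ((p.2 - μ.2.2 : ℤ) : ℝ) / 2) : ℝ) : ℂ) *
        (((X i₁ (p.2 - μ.2.2 + μ.1) s : ℝ) : ℂ) * ((X i₂ (p.2 - μ.2.2 + μ.2.1) s : ℝ) : ℂ))‖ ≤ K * b p.2 := by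
      rw [norm_mul, norm_mul, norm_mul, Complex.norm_real, Complex.norm_real, Complex.norm_real, Complex.norm_real,
        Real.norm_eq_abs, Real.norm_eq_abs, Real.norm_eq_abs, Real.norm_eq_abs, abs_of_pos (Real.rpow_pos_of_pos hε' _),
        hcast]
      refine le_trans ?_ (habsq p.1 p.2)
      simp only [TaoCascade.quadTerm]
      exact single_le_sum₃ TaoCascade.shiftSet
        (fun i₁' i₂' μ' => |α i₁' i₂' p.1 μ'| * (1 + ε₀) ^ ((5 : ℝ) * ((p.2 : ℝ) - (μ'.2.2 : ℝ)) / 2) *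
          (|X i₁' (p.2 - μ'.2.2 + μ'.1) s| * |X i₂' (p.2 - μ'.2.2 + μ'.2.1) s|)) (fun _ _ _ => by positivity) i₁ i₂ hμ
    have hG : ‖pairing g (cascadeWavelet ε₀ (𝒟.ψ p.1) p.2)‖ ≤ ‖g‖ :=
      (norm_pairing_le _ _).trans (by rw [𝒟.norm_cascadeWavelet hε', mul_one])
    rw [norm_mul]
    calc _ ≤ K * b p.2 * ‖g‖ := mul_le_mul hA hG (norm_nonneg _) ((norm_nonneg _).trans hA)
      _ = K * ‖g‖ * b p.2 := by ring
  · refine tsum_congr fun p => ?_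
    simp only [TaoCascade.quadTerm]
    push_cast
    simp only [Finset.sum_mul]

/-! ### The stub -/

/-- **Stub `stub_mild_of_bandField`.** SYNTHESIS direction of Lemma 4.1: a band-structured `H¹⁰_df` curve
`û(t) = ∑_p φ_p(ξ,t) ψ̂_p` whose coefficients `X` solve the lifted Volterra system is a mild solution of the cascade equation
(3.3) with datum `A ψ_{i₀,n₀}` on `[0,S)` (module docstring: one-mode Duhamel fields and Parseval (L), the coefficient identity
`⟨u(s), ψ_{j,k}⟩ = X_{j,k}(s)` and the reindexed cascade operator (R), two dominated interchanges). [cite: Tao2016AveragedNS, §4 Lemma 4.1 (4.14)] -/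
theorem stub_mild_of_bandField :
    ∀ (ε₀ : ℝ), 0 < ε₀ → ε₀ < 1 → ∀ (m : ℕ) (𝒟 : CascadeWaveletData ε₀ m)
    (α : Fin m → Fin m → Fin m → ℤ × ℤ × ℤ → ℝ) (i₀ : Fin m) (n₀ : ℤ) (A S : ℝ)
    (X : Fin m → ℤ → ℝ → ℝ) (u : ℝ → L2C),
    (∀ (i : Fin m) (n : ℤ), Continuous (X i n)) →
    (∀ S' ∈ Ico (0 : ℝ) S, ∃ C : ℝ, ∀ (i : Fin m) (n : ℤ), ∀ t ∈ Icc (0 : ℝ) S',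
      (1 + ((1 + ε₀) ^ n) ^ 10) * |X i n t| ≤ C) →
    (∀ (i : Fin m) (n : ℤ), ∀ t ∈ Ico (0 : ℝ) S,
      X i n t = ∫ ξ : EuclideanSpace ℝ (Fin 3),
        duhamelScalar (A * modeDelta i₀ i n₀ n)
          (fun s => TaoCascade.quadTerm ε₀ α X i n (max s 0)) (heatRate ξ) t * modeWeight 𝒟 i n ξ) →
    (∀ t ∈ Ico (0 : ℝ) S, MemH10df (u t)) → ContinuousInH10On (Ico (0 : ℝ) S) u →
    (∀ t ∈ Ico (0 : ℝ) S, fourierFn (u t) =ᵐ[volume] fun ξ => ∑' p : Fin m × ℤ,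
      ((duhamelScalar (A * modeDelta i₀ p.1 n₀ p.2)
          (fun s => TaoCascade.quadTerm ε₀ α X p.1 p.2 (max s 0)) (heatRate ξ) t : ℝ) : ℂ) •
        fourierFn (cascadeWavelet ε₀ (𝒟.ψ p.1) p.2) ξ) →
    IsMildSolutionFor (cascadeOperatorForm ε₀ 𝒟.ψ α) ((A : ℂ) • cascadeWavelet ε₀ (𝒟.ψ i₀) n₀)
      (Ico (0 : ℝ) S) u := by
  intro ε₀ hε₀ hε₁ m 𝒟 α i₀ n₀ A S X u hXc hapr hVolt hmem hcont hband
  refine ⟨hmem, hcont, fun t ht w hw => ?_⟩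
  have hε' : 0 < 1 + ε₀ := by linarith
  have ht0 : (0 : ℝ) ≤ t := ht.1
  have hIcc : ∀ s ∈ Icc (0 : ℝ) t, s ∈ Ico (0 : ℝ) S := fun s hs => ⟨hs.1, hs.2.trans_lt ht.2⟩
  -- the forcings `Q_p`, the data `δ_p`, the fibres `φ_p(ξ) = φ_p(ξ,t)` at the fixed time `t`
  set Q : Fin m × ℤ → ℝ → ℝ := fun p s => TaoCascade.quadTerm ε₀ α X p.1 p.2 (max s 0) with hQ
  set δ : Fin m × ℤ → ℝ := fun p => A * modeDelta i₀ p.1 n₀ p.2 with hδ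
  set φ : Fin m × ℤ → EuclideanSpace ℝ (Fin 3) → ℝ := fun p ξ => duhamelScalar (δ p) (Q p) (heatRate ξ) t with hφ
  have hQc : ∀ p : Fin m × ℤ, Continuous (Q p) := by
    intro p
    have hmax : Continuous fun s : ℝ => max s 0 := continuous_id.max continuous_const
    simp only [hQ, TaoCascade.quadTerm]
    refine continuous_finsetSum _ fun i₁ _ => continuous_finsetSum _ fun i₂ _ => continuous_finsetSum _ fun μ _ => ?_
    exact continuous_const.mul (((hXc _ _).comp hmax).mul ((hXc _ _).comp hmax))
  have hQcC : ∀ p : Fin m × ℤ, Continuous fun s => ((Q p s : ℝ) : ℂ) := fun p => Complex.continuous_ofReal.comp (hQc p)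
  have hφξ : ∀ p : Fin m × ℤ, Continuous (φ p) := fun p =>
    (continuous_duhamelScalar₂ (δ := δ p) (hQc p)).comp (continuous_heatRate.prodMk continuous_const)
  have hδ0 : ∀ p : Fin m × ℤ, p ≠ (i₀, n₀) → δ p = 0 := fun p hp => by
    have hne : ¬(i₀ = p.1 ∧ n₀ = p.2) := fun h => hp (Prod.ext h.1.symm h.2.symm)
    simp [hδ, modeDelta, hne]
  -- (R) the coefficients of `u s`, `s ∈ [0,t]`, are the `X_{j,k}(s)` (as complex numbers)
  have hcoef : ∀ s ∈ Icc (0 : ℝ) t, ∀ (j : Fin m) (k : ℤ), pairing (u s) (cascadeWavelet ε₀ (𝒟.ψ j) k) = (X j k s : ℂ) := by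
    intro s hs j k
    have hre := stub_modeCoeff_of_bandField ε₀ hε₀ hε₁ m 𝒟 α i₀ n₀ A X s (u s) hXc hs.1 (hband s (hIcc s hs)) j k
    rw [← hVolt j k s (hIcc s hs)] at hre
    rw [eq_ofReal_re_of_im_eq_zero (pairing_im (hmem s (hIcc s hs)).2.1 (isReal_cascadeWavelet ε₀ (𝒟.ψ j) k)), hre]
  -- the a priori bound on `[0,t]` and the mode bounds `K b_n` of the forcings
  obtain ⟨C, hC⟩ := hapr t ht
  set K : ℝ := (∑ i₃ : Fin m, ∑ i₁ : Fin m, ∑ i₂ : Fin m, ∑ μ ∈ TaoCascade.shiftSet, |α i₁ i₂ i₃ μ|) * (2 ^ 10 * C) ^ 2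
    with hK
  set b : ℤ → ℝ := fun n => (((1 + ε₀) ^ n) ^ 2 + ((1 + ε₀) ^ n) ^ 3) / (1 + ((1 + ε₀) ^ n) ^ 10) ^ 2 with hb
  have hbsum : Summable fun p : Fin m × ℤ => b p.2 := summable_fibreBound (by linarith) m
  have hQb : ∀ (p : Fin m × ℤ), ∀ s ∈ Icc (0 : ℝ) t, |Q p s| ≤ K * b p.2 := by
    intro p s hs
    refine (abs_quadTerm_le hε₀ hε₁ α X (fun j k => hC j k (max s 0) ⟨le_max_right _ _, max_le hs.2 ht0⟩) p.1 p.2).trans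
      (le_of_eq ?_)
    simp only [hK, hb, div_pow]
    ring
  -- (F) the one-mode Duhamel fields `F_p = δ_p e^{tΔ}ψ_p + M_t(D)ψ_p`: pairings, via the Fubini lemma and via Parseval
  set F : Fin m × ℤ → L2C := fun p => ((δ p : ℝ) : ℂ) • heat t (cascadeWavelet ε₀ (𝒟.ψ p.1) p.2) +
    fourierMultiplier (duhamelSymbol (fun s => ((Q p s : ℝ) : ℂ)) t) (cascadeWavelet ε₀ (𝒟.ψ p.1) p.2) with hF
  have hFpair : ∀ p : Fin m × ℤ, pairing (F p) w = ((δ p : ℝ) : ℂ) * pairing (heat t (cascadeWavelet ε₀ (𝒟.ψ p.1) p.2)) w +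
      ∫ s in Ioc (0 : ℝ) t, ((Q p s : ℝ) : ℂ) * pairing (heat (t - s) (cascadeWavelet ε₀ (𝒟.ψ p.1) p.2)) w := by
    intro p
    rw [hF, pairing_add_left, pairing_smul_left, pairing_fourierMultiplier_duhamelSymbol (hQcC p) ht0,
      intervalIntegral.integral_of_le ht0]
  have hFp : ∀ p : Fin m × ℤ, pairing (F p) w =
      ∫ ξ, ((φ p ξ : ℝ) : ℂ) * inner ℂ (fourierFn w ξ) (fourierFn (cascadeWavelet ε₀ (𝒟.ψ p.1) p.2) ξ) := by
    intro p
    rw [pairing_eq_integral_fourierFn hw.2.1]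
    refine integral_congr_ae ?_
    filter_upwards [fourierFn_add (((δ p : ℝ) : ℂ) • heat t (cascadeWavelet ε₀ (𝒟.ψ p.1) p.2))
        (fourierMultiplier (duhamelSymbol (fun s => ((Q p s : ℝ) : ℂ)) t) (cascadeWavelet ε₀ (𝒟.ψ p.1) p.2)),
      fourierFn_smul (((δ p : ℝ) : ℂ)) (heat t (cascadeWavelet ε₀ (𝒟.ψ p.1) p.2)), fourierFn_heat t (cascadeWavelet ε₀ (𝒟.ψ p.1) p.2),
      fourierFn_fourierMultiplier (duhamelSymbol (fun s => ((Q p s : ℝ) : ℂ)) t) (cascadeWavelet ε₀ (𝒟.ψ p.1) p.2),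
      coeFn_duhamelSymbol (hQcC p) t] with ξ h1 h2 h3 h4 h5
    rw [show fourierFn (F p) ξ = _ from congrFun (congrArg fourierFn (congrFun hF p)) ξ, h1, h2, h3, h4, h5, smul_smul,
      ← add_smul, ofReal_mul_heatSymbol_add_duhamelSymbolFn (δ p) (Q p) ht0 ξ, inner_smul_right]
  -- (L) `⟨u(t), w⟩ = ∑_p ⟨F_p, w⟩`, dominated by `|φ_p| ≤ |δ_p| + t K b_n`
  have hδabs : Summable fun p : Fin m × ℤ => |δ p| + t * (K * b p.2) :=
    (summable_of_ne_finset_zero (s := {(i₀, n₀)}) (L := .unconditional _) fun p hp => by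
      rw [hδ0 p fun h => hp (Finset.mem_singleton.2 h), abs_zero]).add ((hbsum.mul_left K).mul_left t)
  have hL : pairing (u t) w = ∑' p : Fin m × ℤ, pairing (F p) w := by
    rw [pairing_bandField_eq_tsum hε₀ 𝒟 (c := φ) hφξ (fun p ξ => abs_duhamelScalar_le_of_nonneg (heatRate_nonneg ξ) ht0
      fun s hs => hQb p s hs) hδabs (hband t ht) hw.2.1]
    exact tsum_congr fun p => (hFp p).symm
  -- (R) the Duhamel terms summed over the modes, and the assembly
  have hR := hasSum_integral_duhamelTerms hε' 𝒟 hQc (hbsum.mul_left K) hQb w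
  have hδsum : Summable fun p : Fin m × ℤ => ((δ p : ℝ) : ℂ) * pairing (heat t (cascadeWavelet ε₀ (𝒟.ψ p.1) p.2)) w :=
    summable_of_ne_finset_zero (s := {(i₀, n₀)}) (L := .unconditional _) fun p hp => by
      rw [hδ0 p fun h => hp (Finset.mem_singleton.2 h), Complex.ofReal_zero, zero_mul]
  calc pairing (u t) w = pairing (heat t ((A : ℂ) • cascadeWavelet ε₀ (𝒟.ψ i₀) n₀)) w + ∫ s in Ioc (0 : ℝ) t,
        ∑' p : Fin m × ℤ, ((Q p s : ℝ) : ℂ) * pairing (heat (t - s) (cascadeWavelet ε₀ (𝒟.ψ p.1) p.2)) w := by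
        rw [hL, tsum_congr hFpair, hδsum.tsum_add hR.summable, hR.tsum_eq, tsum_eq_single (i₀, n₀) (fun p hp => ?_)]
        · have h1 : δ (i₀, n₀) = A := by simp [hδ, modeDelta]
          rw [h1, show heat t ((A : ℂ) • cascadeWavelet ε₀ (𝒟.ψ i₀) n₀) = (A : ℂ) • heat t (cascadeWavelet ε₀ (𝒟.ψ i₀) n₀)
            from fourierMultiplier_smul _ _ _, pairing_smul_left]
        · rw [hδ0 p hp, Complex.ofReal_zero, zero_mul]
    _ = pairing (heat t ((A : ℂ) • cascadeWavelet ε₀ (𝒟.ψ i₀) n₀)) w +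
          ∫ s in (0 : ℝ)..t, cascadeOperatorForm ε₀ 𝒟.ψ α (u s) (u s) (heat (t - s) w) := by
        rw [intervalIntegral.integral_of_le ht0]
        congr 1
        refine setIntegral_congr_fun measurableSet_Ioc fun s hs => ?_
        rw [cascadeOperatorForm_eq_tsum_quadTerm hε₀ hε₁ 𝒟 α X (fun j k => hC j k s ⟨hs.1.le, hs.2⟩)
          (hcoef s ⟨hs.1.le, hs.2⟩)]
        refine tsum_congr fun p => ?_
        rw [pairing_heat_left (t - s) w, pairing_swap w]
        simp only [hQ, max_eq_left hs.1.le]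

end Summit.NavierStokesRegularity.NavierStokesRegularity.Theorems.PerpetualPumpPumpTransfer

end
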